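import Mathlib

/-!
# `TemperedCurvatureMoments` (T, stmt-QuantumFields-17721) — negative side, line `Sketch` (card `markov-shielding`):
# the abstract shielding/Hölder stub AS TYPED is false (Bochner junk value); the repaired form

Disprover (cdisprove) note for the lead of crux line `Sketch` (`Cruxes/TemperedCurvatureMoments/SketchIdeator1.lean`,
stub `shielding_abstract`).  The stub reads, for `φ i` conditionally independent given a sub-σ-algebra `m`,

  `|∫ ∏ i, φ i ∂μ| ≤ ∏ i, (∫ ω, |μ[φ i | m] ω| ^ n ∂μ) ^ (n : ℝ)⁻¹`,

the `Lⁿ` norms being written as BOCHNER integrals of `|μ[φ i|m]|ⁿ`.  Nothing in its hypotheses (`φ i ∈ L¹`,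
`∏ φ i ∈ L¹`, the conditional-independence identity) puts `μ[φ i | m]` in `Lⁿ`; when it is not, the Bochner
integral returns the junk value `0`, the right-hand side vanishes and the inequality fails:

* `not_shieldingAbstract_asTyped` — the stub verbatim (universe `0`) is REFUTED: `Ω = ℝ` with Lebesgue measure
  on `(0,1)`, trivial conditioning `m = m₀` (so `μ[φ|m] = φ` and conditional independence is automatic), `n = 2`,
  `φ₀(x) = x^{-1/2} ∈ L¹ ∖ L²`, `φ₁ = 1`: the left side is `∫₀¹ x^{-1/2} dx = 2`, the right side is
  `(∫ |φ₀|²)^{1/2} · (∫ 1)^{1/2} = 0^{1/2} · 1 = 0`.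
* `shielding_bdd` — the REPAIRED form the line actually needs (its `φ i = c_k (F(τ_{xᵢ}Ũ) − m_k)` are bounded):
  with `|φ i| ≤ B i` a.e. every conditional expectation is a.e. bounded by `B i` and `|∫ ∏ φ i| ≤ ∏ B i` by the
  tower property.  (With `MemLp (μ[φ i|m]) n μ` hypotheses the general statement is Mathlib's `eLpNorm` Hölder.)

Repair for the skeleton: add `(hB : ∀ i, ∀ᵐ ω ∂μ, |φ i ω| ≤ B i)` (or `MemLp (μ[φ i | m]) n μ`, or state the
right side with `eLpNorm`) to `shielding_abstract`; `mesoTempered_of_shieldedMomentBound` only feeds bounded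
observables, so nothing downstream is lost.
-/

noncomputable section

open MeasureTheory Set Filter
open scoped ENNReal

namespace Summit.QuantumFields.YangMills.Theorems.TemperedCurvatureMoments.Negative

/-- Lebesgue measure restricted to `(0,1)` (local notation, not a definition). -/
local notation "μ01" => (Measure.restrict (volume : Measure ℝ) (Set.Ioo (0 : ℝ) 1))

/-- `μ01` is a probability measure. -/
theorem isProbabilityMeasure_μ01 : IsProbabilityMeasure μ01 :=
  ⟨by simp [Real.volume_Ioo]⟩

/-- `x^{-1/2}` is integrable on `(0,1)`. -/
theorem rpow_neg_half_integrable : Integrable (fun x : ℝ => x ^ (-(1 / 2 : ℝ))) μ01 :=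
  (intervalIntegral.integrableOn_Ioo_rpow_iff one_pos).2 (by norm_num)

/-- `∫₀¹ x^{-1/2} dx = 2`. -/
theorem integral_rpow_neg_half : ∫ x, (fun x : ℝ => x ^ (-(1 / 2 : ℝ))) x ∂μ01 = 2 := by
  have h1 : ∫ x, (fun x : ℝ => x ^ (-(1 / 2 : ℝ))) x ∂μ01 = ∫ x in Ioc (0 : ℝ) 1, x ^ (-(1 / 2 : ℝ)) := by
    rw [integral_Ioc_eq_integral_Ioo]
  rw [h1, ← intervalIntegral.integral_of_le zero_le_one, integral_rpow (Or.inl (by norm_num))]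
  norm_num [Real.zero_rpow]

/-- `|x^{-1/2}|² = x^{-1}` is NOT integrable on `(0,1)`. -/
theorem not_integrable_rpow_neg_half_sq :
    ¬ Integrable (fun x : ℝ => |(fun x : ℝ => x ^ (-(1 / 2 : ℝ))) x| ^ (2 : ℕ)) μ01 := by
  intro h
  have h' : IntegrableOn (fun x : ℝ => x ^ (-1 : ℝ)) (Ioo (0 : ℝ) 1) := by
    refine (integrableOn_congr_fun (fun x hx => ?_) measurableSet_Ioo).1 h
    have hx0 : 0 < x := hx.1
    simp only
    rw [abs_of_nonneg (Real.rpow_nonneg hx0.le _), ← Real.rpow_natCast, ← Real.rpow_mul hx0.le]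
    norm_num
  have := (intervalIntegral.integrableOn_Ioo_rpow_iff one_pos).1 h'
  norm_num at this

/-- **The stub `shielding_abstract` of line `Sketch`, AS TYPED, is false.**  The refuted statement (inside the
negation) is the stub verbatim at universe `0`, binders as in `Cruxes/TemperedCurvatureMoments/SketchIdeator1.lean`:
tower property plus generalised Hölder with the `Lⁿ` norms written as Bochner integrals and no `Lⁿ` hypothesis
on the conditional expectations.  Witness: Lebesgue on `(0,1)`, `m = m₀`, `n = 2`, `φ = (x^{-1/2}, 1)`. -/
theorem not_shieldingAbstract_asTyped :
    ¬ ∀ {Ω : Type} {m m0 : MeasurableSpace Ω} (_hm : m ≤ m0) (μ : Measure Ω) [IsProbabilityMeasure μ] {n : ℕ}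
        (_hn : 0 < n) (φ : Fin n → Ω → ℝ) (_hφ : ∀ i, Integrable (φ i) μ)
        (_hprod : Integrable (fun ω => ∏ i, φ i ω) μ)
        (_hci : μ[(fun ω => ∏ i, φ i ω) | m] =ᵐ[μ] fun ω => ∏ i, (μ[φ i | m]) ω),
        |∫ ω, ∏ i, φ i ω ∂μ| ≤ ∏ i, (∫ ω, |(μ[φ i | m]) ω| ^ n ∂μ) ^ ((n : ℝ)⁻¹) := by
  intro h
  haveI : IsProbabilityMeasure μ01 := isProbabilityMeasure_μ01
  have hφ : ∀ i, Integrable ((![fun x : ℝ => x ^ (-(1 / 2 : ℝ)), fun _ => 1] : Fin 2 → ℝ → ℝ) i) μ01 := by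
    intro i
    fin_cases i
    · exact rpow_neg_half_integrable
    · exact integrable_const _
  have hprodfun : (fun ω => ∏ i, (![fun x : ℝ => x ^ (-(1 / 2 : ℝ)), fun _ => 1] : Fin 2 → ℝ → ℝ) i ω) =
      fun x : ℝ => x ^ (-(1 / 2 : ℝ)) := by
    funext ω
    simp [Fin.prod_univ_two]
  have hprod : Integrable
      (fun ω => ∏ i, (![fun x : ℝ => x ^ (-(1 / 2 : ℝ)), fun _ => 1] : Fin 2 → ℝ → ℝ) i ω) μ01 := by
    rw [hprodfun]; exact rpow_neg_half_integrable
  have hm : (inferInstance : MeasurableSpace ℝ) ≤ (inferInstance : MeasurableSpace ℝ) := le_rfl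
  have hc0 : μ01[(fun x : ℝ => x ^ (-(1 / 2 : ℝ))) | (inferInstance : MeasurableSpace ℝ)] =
      fun x : ℝ => x ^ (-(1 / 2 : ℝ)) :=
    condExp_of_stronglyMeasurable hm (measurable_id.pow_const _).stronglyMeasurable rpow_neg_half_integrable
  have hc1 : μ01[(fun _ : ℝ => (1 : ℝ)) | (inferInstance : MeasurableSpace ℝ)] = fun _ => 1 :=
    condExp_const hm (1 : ℝ)
  have hci : μ01[(fun ω => ∏ i, (![fun x : ℝ => x ^ (-(1 / 2 : ℝ)), fun _ => 1] : Fin 2 → ℝ → ℝ) i ω) |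
        (inferInstance : MeasurableSpace ℝ)] =ᵐ[μ01]
      fun ω => ∏ i, (μ01[(![fun x : ℝ => x ^ (-(1 / 2 : ℝ)), fun _ => 1] : Fin 2 → ℝ → ℝ) i |
        (inferInstance : MeasurableSpace ℝ)]) ω := by
    refine Filter.EventuallyEq.of_eq ?_
    rw [hprodfun]
    funext ω
    simp only [Fin.prod_univ_two, Matrix.cons_val_zero, Matrix.cons_val_one, Matrix.cons_val_fin_one]
    rw [hc0, hc1]
    simp
  have key := h hm μ01 (n := 2) two_pos _ hφ hprod hci
  have hL : |∫ ω, ∏ i, (![fun x : ℝ => x ^ (-(1 / 2 : ℝ)), fun _ => 1] : Fin 2 → ℝ → ℝ) i ω ∂μ01| = 2 := by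
    rw [hprodfun, integral_rpow_neg_half]; norm_num
  have hR : ∏ i, (∫ ω, |(μ01[(![fun x : ℝ => x ^ (-(1 / 2 : ℝ)), fun _ => 1] : Fin 2 → ℝ → ℝ) i |
      (inferInstance : MeasurableSpace ℝ)]) ω| ^ (2 : ℕ) ∂μ01) ^ (((2 : ℕ) : ℝ)⁻¹) = 0 := by
    rw [Fin.prod_univ_two]
    have h0 : (∫ ω, |(μ01[(![fun x : ℝ => x ^ (-(1 / 2 : ℝ)), fun _ => 1] : Fin 2 → ℝ → ℝ) 0 |
        (inferInstance : MeasurableSpace ℝ)]) ω| ^ (2 : ℕ) ∂μ01) = 0 := by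
      have : (![fun x : ℝ => x ^ (-(1 / 2 : ℝ)), fun _ => 1] : Fin 2 → ℝ → ℝ) 0 =
          fun x : ℝ => x ^ (-(1 / 2 : ℝ)) := rfl
      rw [this, hc0]
      exact integral_undef not_integrable_rpow_neg_half_sq
    rw [h0, Real.zero_rpow (by norm_num)]
    simp
  rw [hL, hR] at key
  norm_num at key

/-- **The repaired shielding inequality (bounded observables).**  If the `φ i` are a.e. bounded, `|φ i| ≤ B i`,
and conditionally independent given `m` in the product sense, then `|∫ ∏ φ i| ≤ ∏ i, B i` — the form in which
Markov shielding is used downstream (each shielded factor `μ[φ i|m]` is a.e. bounded by `B i`, so its `Lⁿ` norm is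
honest and `≤ B i`).  Tower property + `ae_bdd_abs_condExp_of_ae_bdd_abs`. -/
theorem shielding_bdd {Ω : Type*} {m m0 : MeasurableSpace Ω} (hm : m ≤ m0) (μ : Measure Ω)
    [IsProbabilityMeasure μ] {n : ℕ} (φ : Fin n → Ω → ℝ) (B : Fin n → ℝ)
    (hB : ∀ i, ∀ᵐ ω ∂μ, |φ i ω| ≤ B i)
    (hci : μ[(fun ω => ∏ i, φ i ω) | m] =ᵐ[μ] fun ω => ∏ i, (μ[φ i | m]) ω) :
    |∫ ω, ∏ i, φ i ω ∂μ| ≤ ∏ i, B i := by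
  have hbd : ∀ i, ∀ᵐ ω ∂μ, |(μ[φ i | m]) ω| ≤ B i := fun i =>
    ae_bdd_abs_condExp_of_ae_bdd_abs (m := m) (hB i)
  have htower : ∫ ω, ∏ i, φ i ω ∂μ = ∫ ω, (μ[(fun ω => ∏ i, φ i ω) | m]) ω ∂μ :=
    (integral_condExp hm).symm
  rw [htower, integral_congr_ae hci]
  have hall : ∀ᵐ ω ∂μ, ∀ i, |(μ[φ i | m]) ω| ≤ B i := ae_all_iff.2 hbd
  calc |∫ ω, ∏ i, (μ[φ i | m]) ω ∂μ| ≤ ∫ ω, |∏ i, (μ[φ i | m]) ω| ∂μ := abs_integral_le_integral_abs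
    _ ≤ ∫ _ω, ∏ i, B i ∂μ := by
        refine integral_mono_of_nonneg (Eventually.of_forall fun _ => abs_nonneg _) (integrable_const _) ?_
        filter_upwards [hall] with ω hω
        rw [Finset.abs_prod]
        exact Finset.prod_le_prod (fun i _ => abs_nonneg _) fun i _ => hω i
    _ = ∏ i, B i := by simp

end Summit.QuantumFields.YangMills.Theorems.TemperedCurvatureMoments.Negative

end
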